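import Mathlib
import Summits.NavierStokesRegularity.NavierStokesRegularity.Theorems.L3TimeExponentPincerRingDatumLaplacian
import Literature.Analysis.FluidPDE.AxisymSmallSwirlL4
import Literature.Analysis.FluidPDE.LocalBiotSavartCalculus
import Literature.Analysis.FluidPDE.VectorCalculusProofs
import Literature.Analysis.FluidPDE.AxisymQuotientBounds
import Literature.Analysis.FluidPDE.AxisymHouLiVariables
import HarnessLib.Audit
import HarnessLib

/-!
# L3TimeExponentPincer — ring datum calculus II: the vortex ring `u₀ = curl (F(|x|²) J)` is
# axisymmetric without swirl, divergence free, with `ω_θ/r = −(4|x|²F'' + 10F')(|x|²)`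

Support kernel for the crux `L3CascadeJaw` (item stmt-NavierStokesRegularity-19499): second
calculus step of the explicit ring datum required by `lpPersistence_of_ringData`.  For a smooth
profile `F` let `A(x) = F(|x|²) · Jx` (`J = rotGen`) and `u₀ = curl A`.  Then:

* `divergence_radial_smul_rotGen` — `div A = 0` (`⟪Jx, ∇F(|x|²)⟫ = 2F'⟪Jx, x⟫ = 0`);
* `isAxisymmetric_radial_smul_rotGen`, `isAxisymmetric_ringField`, `hasNoSwirl_ringField`,
  `isDivFree_ringField` — `A` and `u₀` are axisymmetric, `u₀` has no swirl and is divergence free;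
* `curl_ringField` — `curl u₀ = curl curl A = −ΔA = G · J`, `G(x) = −(4|x|²F''(|x|²) + 10F'(|x|²))`
  (`curl_curl_eq_neg_laplacian`, `laplacian_comp_norm_sq_smul_rotGen`);
* `angVortQuot_ringField` — **`ω_θ/r = angVortQuot u₀ = G`**, a RADIAL function (off the axis
  `radQuot (r²G) = G`, everywhere by continuity, `eq_of_eq_off_axis`).

So the sign and size of `η₀ = ω_θ/r` of the ring datum are read off the ODE expression
`4sF'' + 10F' = 4 s^{-3/2} (s^{5/2} F')'`: `η₀ ≡ 0` where `s^{5/2}F'` is constant (the dipole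
`F = s^{-3/2}`), `η₀ ≥ 0` where `s^{5/2}F'` decreases. WHAT THIS IS NOT: pure calculus.
-/

namespace Summit.NavierStokesRegularity.NavierStokesRegularity.Theorems.L3TimeExponentPincerRingDatumVorticity

open Real Literature.Analysis.FluidPDE InnerProductSpace
open Summit.NavierStokesRegularity.NavierStokesRegularity.Theorems.L3TimeExponentPincerRingDatumLaplacian
open scoped Laplacian RealInnerProductSpace ContDiff

variable {F : ℝ → ℝ}

/-- The azimuthal potential `A = F(|x|²) J` is smooth for smooth `F`. -/
theorem contDiff_radial_smul_rotGen {n : WithTop ℕ∞} (hF : ContDiff ℝ n F) :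
    ContDiff ℝ n (fun y : EuclideanSpace ℝ (Fin 3) => F (‖y‖ ^ 2) • rotGen y) :=
  (hF.comp (contDiff_norm_sq ℝ)).smul contDiff_rotGen

/-- `F(|·|²)` is an axisymmetric scalar. -/
theorem isAxisymmetricScalar_comp_norm_sq' (F : ℝ → ℝ) :
    IsAxisymmetricScalar (fun y : EuclideanSpace ℝ (Fin 3) => F (‖y‖ ^ 2)) := by
  intro θ x
  simp only [norm_rotZ]

/-- **`div (F(|x|²) J) = 0`.** -/
theorem divergence_radial_smul_rotGen (hF : Differentiable ℝ F) (x : EuclideanSpace ℝ (Fin 3)) :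
    VectorCalculus.divergence (fun y : EuclideanSpace ℝ (Fin 3) => F (‖y‖ ^ 2) • rotGen y) x = 0 := by
  have hf : DifferentiableAt ℝ (fun y : EuclideanSpace ℝ (Fin 3) => F (‖y‖ ^ 2)) x :=
    (hasFDerivAt_comp_norm_sq hF x).differentiableAt
  have h := divergence_smul_rotGenL (isAxisymmetricScalar_comp_norm_sq' F) hf
  have e : (fun y : EuclideanSpace ℝ (Fin 3) => F (‖y‖ ^ 2) • rotGenL y) =
      fun y => F (‖y‖ ^ 2) • rotGen y := by
    funext y; rw [rotGenL_apply]
  rwa [e] at h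

/-- **`A = F(|x|²) J` is axisymmetric.** -/
theorem isAxisymmetric_radial_smul_rotGen (F : ℝ → ℝ) :
    IsAxisymmetric (fun y : EuclideanSpace ℝ (Fin 3) => F (‖y‖ ^ 2) • rotGen y) := by
  have h := isAxisymmetric_smul_rotGenL (isAxisymmetricScalar_comp_norm_sq' F)
  have e : (fun y : EuclideanSpace ℝ (Fin 3) => F (‖y‖ ^ 2) • rotGenL y) =
      fun y => F (‖y‖ ^ 2) • rotGen y := by
    funext y; rw [rotGenL_apply]
  rwa [e] at h

/-- **The ring field `u₀ = curl (F(|x|²) J)` is axisymmetric** (`F ∈ C¹`). -/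
theorem isAxisymmetric_ringField (hF : ContDiff ℝ 1 F) :
    IsAxisymmetric (curl fun y : EuclideanSpace ℝ (Fin 3) => F (‖y‖ ^ 2) • rotGen y) :=
  (isAxisymmetric_radial_smul_rotGen F).curl
    ((contDiff_radial_smul_rotGen hF).differentiable (by simp))

/-- **The ring field has no swirl.** -/
theorem hasNoSwirl_ringField (hF : Differentiable ℝ F) :
    HasNoSwirl (curl fun y : EuclideanSpace ℝ (Fin 3) => F (‖y‖ ^ 2) • rotGen y) := by
  intro x
  have hf : DifferentiableAt ℝ (fun y : EuclideanSpace ℝ (Fin 3) => F (‖y‖ ^ 2)) x :=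
    (hasFDerivAt_comp_norm_sq hF x).differentiableAt
  have h := swirl_curl_smul_rotGenL hf
  have e : (fun y : EuclideanSpace ℝ (Fin 3) => F (‖y‖ ^ 2) • rotGenL y) =
      fun y => F (‖y‖ ^ 2) • rotGen y := by
    funext y; rw [rotGenL_apply]
  rwa [e] at h

/-- **The ring field is divergence free** (`div curl = 0`, `F ∈ C²`). -/
theorem isDivFree_ringField (hF : ContDiff ℝ 2 F) :
    VectorCalculus.IsDivFree (curl fun y : EuclideanSpace ℝ (Fin 3) => F (‖y‖ ^ 2) • rotGen y) :=
  fun x => divergence_curl_eq_zero_holds _ (contDiff_radial_smul_rotGen hF) x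

/-- **The vorticity of the ring field**: `curl u₀ = curl curl A = −ΔA = G · J` with
`G(x) = −(4|x|² F''(|x|²) + 10 F'(|x|²))` (`F ∈ C²`). -/
theorem curl_ringField (hF : ContDiff ℝ 2 F) (x : EuclideanSpace ℝ (Fin 3)) :
    curl (curl fun y : EuclideanSpace ℝ (Fin 3) => F (‖y‖ ^ 2) • rotGen y) x =
      (-(4 * ‖x‖ ^ 2 * deriv (deriv F) (‖x‖ ^ 2) + 10 * deriv F (‖x‖ ^ 2))) • rotGen x := by
  have hdiv : VectorCalculus.IsDivFree (fun y : EuclideanSpace ℝ (Fin 3) => F (‖y‖ ^ 2) • rotGen y) :=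
    fun y => divergence_radial_smul_rotGen (hF.differentiable (by norm_num)) y
  rw [curl_curl_eq_neg_laplacian (contDiff_radial_smul_rotGen hF) hdiv x,
    laplacian_comp_norm_sq_smul_rotGen hF x, neg_smul]

/-- **`ω_θ/r` of the ring field is the radial function `G = −(4sF'' + 10F')(|x|²)`**
(`F ∈ C⁴`; `angVortQuot u₀ = radQuot (swirl (curl u₀))`, `swirl (G J) = r² G`, so off the axis
`angVortQuot u₀ = G`, and everywhere by continuity). -/
theorem angVortQuot_ringField (hF : ContDiff ℝ 4 F) (x : EuclideanSpace ℝ (Fin 3)) :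
    angVortQuot (curl fun y : EuclideanSpace ℝ (Fin 3) => F (‖y‖ ^ 2) • rotGen y) x =
      -(4 * ‖x‖ ^ 2 * deriv (deriv F) (‖x‖ ^ 2) + 10 * deriv F (‖x‖ ^ 2)) := by
  set u : EuclideanSpace ℝ (Fin 3) → EuclideanSpace ℝ (Fin 3) :=
    curl fun y : EuclideanSpace ℝ (Fin 3) => F (‖y‖ ^ 2) • rotGen y with hu
  set G : EuclideanSpace ℝ (Fin 3) → ℝ := fun y =>
    -(4 * ‖y‖ ^ 2 * deriv (deriv F) (‖y‖ ^ 2) + 10 * deriv F (‖y‖ ^ 2)) with hG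
  have hF2 : ContDiff ℝ 2 F := hF.of_le (by norm_num)
  -- smoothness of `u` and of `G`
  have hA : ContDiff ℝ 4 (fun y : EuclideanSpace ℝ (Fin 3) => F (‖y‖ ^ 2) • rotGen y) :=
    contDiff_radial_smul_rotGen hF
  have hu3 : ContDiff ℝ 3 u := by
    rw [hu]; exact contDiff_curl (n := 3) (by exact_mod_cast hA)
  have hF' : ContDiff ℝ 3 (deriv F) := ContDiff.deriv' (n := 3) (by exact_mod_cast hF)
  have hF'' : ContDiff ℝ 2 (deriv (deriv F)) := ContDiff.deriv' (n := 2) (by exact_mod_cast hF')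
  have hGc : ContDiff ℝ 2 G := by
    have h1 : ContDiff ℝ 2 (fun y : EuclideanSpace ℝ (Fin 3) => ‖y‖ ^ 2) := contDiff_norm_sq ℝ
    have h2 : ContDiff ℝ 2 (fun y : EuclideanSpace ℝ (Fin 3) => deriv (deriv F) (‖y‖ ^ 2)) :=
      hF''.comp h1
    have h3 : ContDiff ℝ 2 (fun y : EuclideanSpace ℝ (Fin 3) => deriv F (‖y‖ ^ 2)) :=
      (hF'.of_le (by norm_num)).comp h1
    exact (((contDiff_const.mul h1).mul h2).add (contDiff_const.mul h3)).neg
  -- `swirl (curl u) = r² G`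
  have hsw : ∀ y, swirl (curl u) y = (y 0 ^ 2 + y 1 ^ 2) * G y := by
    intro y
    have e : curl u = fun z => G z • rotGenL z := by
      funext z; rw [hu, curl_ringField hF2 z, rotGenL_apply]
    rw [e, swirl_smul_rotGenL]
  -- the axisymmetric scalar `S = swirl (curl u)` vanishes on the axis
  have hax : IsAxisymmetric u := by rw [hu]; exact isAxisymmetric_ringField (hF.of_le (by norm_num))
  have hSax : IsAxisymmetricScalar (swirl (curl u)) :=
    hax.isAxisymmetricScalar_swirl_curl (hu3.differentiable (by norm_num))
  have hS2 : ContDiff ℝ 2 (swirl (curl u)) := contDiff_swirl (contDiff_curl (n := 2) (by exact_mod_cast hu3))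
  have hS0 : ∀ y, cylRadius y = 0 → swirl (curl u) y = 0 := by
    intro y hy
    obtain ⟨h0, h1⟩ := (cylRadius_eq_zero_iff y).1 hy
    rw [hsw y, h0, h1]; ring
  -- off the axis: `angVortQuot u = S / r² = G`
  have hoff : ∀ z, cylRadius z ≠ 0 → angVortQuot u z = G z := by
    intro z hz
    rw [angVortQuot, radQuot_eq_div hS2 hSax hS0 hz, hsw z, ← cylRadius_sq, mul_div_cancel_left₀ _
      (pow_ne_zero 2 hz)]
  -- everywhere by continuity
  have hcont : Continuous (angVortQuot u) :=
    (contDiff_angVortQuot (n := 0) (by exact_mod_cast hu3)).continuous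
  exact eq_of_eq_off_axis hcont hGc.continuous hoff x

end Summit.NavierStokesRegularity.NavierStokesRegularity.Theorems.L3TimeExponentPincerRingDatumVorticity
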